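import Literature.AlgebraicGeometry.HodgeTheory.SurjectivePullbackAlgebraicClasses
import Literature.AlgebraicGeometry.HodgeTheory.HodgeTypePullback
import Literature.AlgebraicGeometry.HodgeTheory.HodgeFiltrationModelsReductionProofs
import Literature.AlgebraicGeometry.HodgeTheory.ComplexConjugationHolds
import Literature.AlgebraicGeometry.Motives.SegreEmbedding
import Literature.AlgebraicGeometry.Motives.SubschemeCycles
import Literature.AlgebraicGeometry.Motives.AbelianVarietyIsogenyProofs
import Literature.AlgebraicGeometry.Motives.VarietiesProperProofs
import Literature.AlgebraicGeometry.Motives.VarietiesDimensionProofs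
import Literature.AlgebraicGeometry.Morphisms.ProperIrreducibleInAffine
import Literature.NumberTheory.Transcendental.AnalytificationConnected
import Literature.Topology.KrullDimensionDrop
import HarnessLib

/-!
# The middle-degree Hodge conjecture from algebraicity on affine-complement sections
# (product trick `X₀ × ℙ¹` + degree trick)

Family `hodge`, layer `Literature/AlgebraicGeometry/HodgeTheory`; namespace
`Literature.AlgebraicGeometry.HodgeTheory`. Theorem-only file (no definition, no named fact, sorry-free).

Call a closed immersion `f : Y ⟶ X` of smooth projective complex varieties an ADMISSIBLE PROPER SECTION
of ample type in codimension-`p` range if `X ∖ f(Y)` is non-empty and covered by a finite set `s` of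
affine opens with `2p + |s| ≤ dim X` (the range in which `f^*` is injective on `H²ᵖ`, Voisin II
Thm. 1.23). Consider the statement

  (Sec_p)  every rational `(p,p)`-class `c` on every smooth projective `X` of dimension `2p + 1`
           becomes ALGEBRAIC on some admissible proper section: `f^* c ∈ algebraicClasses Y p`

(the critical slice `dim X = 2p + 1` of the crux `SectionalSource` of the Hodge-conjecture route
`AmpleAdicLefschetz` in `Summits/`). This file proves that (Sec_p) ALONE implies the Hodge conjecture
in the middle degree `2p` of every smooth projective `2p`-fold
(`mem_algebraicClasses_middle_of_affineComplSections`): for `X₀` of dimension `2p` and `c₀` a rational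
`(p,p)`-class, put `X := X₀ × ℙ¹` and `c := pr₁^* c₀` (rational, of type `(p,p)`: Voisin I §7.3.2,
the tree's `preservesHodgeType_of_nonempty_hodgeModel`); (Sec_p) gives `(m, Y, f, s)` and
`2p + |s| ≤ 2p + 1` with `X ∖ f(Y) ≠ ∅` forces `s = {U}`, ONE affine open `U = X ∖ f(Y)`; then

* `surjective_comp_fst_of_isAffineOpen_compl` — **`g := f ≫ pr₁ : Y → X₀` is surjective**: otherwise
  a slice `{x₀} × ℙ¹` misses `f(Y)` and is a complete curve inside the affine `U` (de Jong 1996, proof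
  of Lemma 4.13 (ii): proper + affine ⇒ finite ⇒ a point; Hartshorne II Ex. 4.5), stated for any
  positive-dimensional smooth projective factor `T` in place of `ℙ¹`;
* `eq_of_isClosedImmersion_of_surjective` — **`dim Y = 2p`**: a proper closed subset of the
  irreducible `X` has dimension `< 2p + 1` (Görtz–Wedhorn I Prop. 5.30), and a closed surjection onto
  `X₀` forces `dim Y ≥ 2p` (Prop. 12.12);
* so `g` is surjective and equidimensional, `g^* c₀ = f^* c` is algebraic on `Y`, and ALGEBRAICITY
  DESCENDS along `g` by the degree trick `g_* g^* = deg g • id` (Voisin I §7.3.2 Remark 7.29; the tree's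
  `mem_algebraicClasses_of_map_mem_of_surjective`).

In particular (Sec_2) implies the Hodge conjecture for `(2,2)`-classes on all smooth projective
fourfolds (`mem_algebraicClasses_fourfold_of_affineComplSections`). Consumer: the hardness record of
the crux `SectionalSource` (`Summits/HodgeConjecture/HodgeConjecture/Cruxes/SectionalSource/Hardness.lean`).

## References

* C. Voisin, *Hodge Theory and Complex Algebraic Geometry I* (2002), §7.3.2, Lemma 7.28, Remark 7.29.
  [VoisinHodgeI2002]
* C. Voisin, *Hodge Theory and Complex Algebraic Geometry II* (2003), §1.2.2 Thm. 1.23. [VoisinHodgeII2003]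
* P. Deligne, *The Hodge conjecture*, Clay Mathematics Institute (2000), §1. [Deligne2000]
* R. Hartshorne, *Algebraic Geometry* (1977), II Ex. 3.20–3.22, Ex. 4.5, Cor. 4.8. [Hartshorne1977]
* U. Görtz, T. Wedhorn, *Algebraic Geometry I* (2nd ed. 2020), Prop. 5.30, Prop. 12.12. [GortzWedhorn2020]
* A. J. de Jong, *Smoothness, semi-stability and alterations*, Publ. Math. IHÉS 83 (1996), Lemma 4.13.
  [DeJong1996]
-/

noncomputable section

open CategoryTheory CategoryTheory.Limits AlgebraicGeometry MonoidalCategory CartesianMonoidalCategory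
open Literature.AlgebraicGeometry.Motives

universe u

namespace Literature.AlgebraicGeometry.HodgeTheory

section HodgeTheory

/-! ### Geometric inputs -/

/-- A smooth projective variety of relative dimension `n` over a field `k` has topological Krull
dimension exactly `n` (as an element of `WithBot ℕ∞`): it is non-empty (geometrically irreducible
over the point `Spec k`) and smooth of relative dimension `n`
(`Motives.topologicalKrullDim_eq_of_smoothOfRelativeDimension`; Hartshorne II Ex. 3.20, III.10;
Görtz–Wedhorn I, Lemma 6.26 with Lemma 5.7 (4)).
[cite: Hartshorne1977, II Ex. 3.20 and III.10 (relative dimension)] -/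
theorem topologicalKrullDim_left_eq_of_isSmoothProjective {k : Type u} [Field k] {n : ℕ}
    {X : SchemeOver k} (h : IsSmoothProjective n X) :
    topologicalKrullDim X.left = (n : WithBot ℕ∞) := by
  haveI := h.smoothOfRelativeDimension
  haveI := h.geometricallyIrreducible
  haveI : IrreducibleSpace X.left :=
    GeometricallyIrreducible.irreducibleSpace_of_subsingleton X.hom
  exact topologicalKrullDim_eq_of_smoothOfRelativeDimension X.hom n

/-- The constant slice `(x, 𝟙) : T ⟶ X₀ ⊗ T` attached to a `T`-valued point `x : T ⟶ X₀` is a closed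
immersion when `X₀` is separated over `ℂ`: it is a section of the separated projection
`X₀ ⊗ T → T` (Hartshorne II Cor. 4.2 and Ex. 4.8; Stacks 01KT).
[cite: Hartshorne1977, II Cor. 4.2 and Ex. 4.8] -/
theorem isClosedImmersion_lift_id_left_of_isSeparated {X0 T : SchemeOver ℂ} (x : T ⟶ X0)
    [IsSeparated X0.hom] : IsClosedImmersion (lift x (𝟙 T)).left := by
  have h : (lift x (𝟙 T)).left ≫ (snd X0 T).left = 𝟙 _ := by
    rw [← Over.comp_left, lift_snd]
    rfl
  haveI : IsSeparated (snd X0 T).left :=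
    inferInstanceAs (IsSeparated (pullback.snd X0.hom T.hom))
  haveI : IsClosedImmersion ((lift x (𝟙 T)).left ≫ (snd X0 T).left) := by
    rw [h]; infer_instance
  exact IsClosedImmersion.of_comp _ (snd X0 T).left

/-- **An admissible section of `X₀ × T` with ONE affine complement dominates `X₀`.** Let `X₀` and `T`
be smooth projective complex varieties with `dim T = d ≥ 1`, `f : Y ↪ X₀ × T` a closed immersion and
`U ⊆ X₀ × T` an affine open with `U = (X₀ × T) ∖ f(Y)`. Then `Y → X₀ × T → X₀` is surjective.
Proof: the composite is proper, so its image is closed; if it were not everything, its open complement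
would contain a complex point `x₀` (closed points are dense in locally closed subsets of the Jacobson
scheme `X₀`, and are complex points); the slice `T ≅ {x₀} × T ↪ X₀ × T` is a closed immersion whose
image misses `f(Y)`, hence lies in the affine open `U`; the image is closed, irreducible and of Krull
dimension `d ≥ 1`, contradicting "a closed irreducible positive-dimensional subset of a proper
`ℂ`-scheme lies in no affine open" (de Jong 1996, proof of Lemma 4.13 (ii): proper + affine ⇒ finite
⇒ discrete; Hartshorne II Ex. 4.5: a complete curve is not affine).
[cite: DeJong1996, Lemma 4.13 (ii) (proof), pp. 69–70] [cite: Hartshorne1977, II Ex. 4.5 and Cor. 4.8] -/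
theorem surjective_comp_fst_of_isAffineOpen_compl {n d : ℕ} {X0 T Y : SchemeOver ℂ}
    (hX0 : IsSmoothProjective n X0) (hT : IsSmoothProjective d T) (hd : 1 ≤ d)
    (f : Y ⟶ X0 ⊗ T) [IsClosedImmersion f.left]
    (U : (X0 ⊗ T).left.Opens) (hU : IsAffineOpen U)
    (hUc : (U : Set (X0 ⊗ T).left) = (Set.range f.left.base)ᶜ) :
    Surjective (f ≫ CartesianMonoidalCategory.fst X0 T).left := by
  -- properness bookkeeping: `Y → X₀ × T → X₀` is proper, `X₀ × T` is proper over `ℂ`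
  haveI : IsProper X0.hom := IsSmoothProjective.isProper_holds hX0
  haveI : IsProper T.hom := IsSmoothProjective.isProper_holds hT
  haveI : IsProper (X0 ⊗ T).hom :=
    IsSmoothProjective.isProper_holds (IsSmoothProjective.tensor_holds hX0 hT)
  haveI : IsProper (fst X0 T).left := inferInstanceAs (IsProper (pullback.fst X0.hom T.hom))
  haveI : IsProper (f ≫ fst X0 T).left := by
    rw [Over.comp_left]; infer_instance
  by_contra hsurj
  -- a complex point `x₀` of `X₀` missed by `Y → X₀`
  have hcl : IsClosed (Set.range (f ≫ fst X0 T).left.base) :=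
    (f ≫ fst X0 T).left.isClosedMap.isClosed_range
  have hne : (Set.range (f ≫ fst X0 T).left.base)ᶜ.Nonempty := by
    rw [Set.nonempty_compl]
    intro h
    exact hsurj ⟨Set.range_eq_univ.mp h⟩
  obtain ⟨x0, hx0⟩ := ComplexPoints.exists_pt_mem hne hcl.isOpen_compl.isLocallyClosed
  rw [Set.mem_compl_iff, Set.mem_range, not_exists] at hx0
  -- the slice `τ = (x₀, 𝟙) : T ≅ {x₀} × T ↪ X₀ × T`
  obtain ⟨τ, hτ⟩ : ∃ τ : T ⟶ X0 ⊗ T, τ = lift (toSpecOver T ≫ x0) (𝟙 T) := ⟨_, rfl⟩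
  have hτfst : τ ≫ fst X0 T = toSpecOver T ≫ x0 := by rw [hτ, lift_fst]
  haveI : IsClosedImmersion τ.left := by
    rw [hτ]; exact isClosedImmersion_lift_id_left_of_isSeparated _
  haveI := hT.geometricallyIrreducible
  haveI : IrreducibleSpace T.left := GeometricallyIrreducible.irreducibleSpace_of_subsingleton T.hom
  have hCcl : IsClosed (Set.range τ.left.base) := τ.left.isClosedEmbedding.isClosed_range
  have hC : IsIrreducible (Set.range τ.left.base) := by
    rw [← Set.image_univ]
    exact (IrreducibleSpace.isIrreducible_univ _).image _ τ.left.continuous.continuousOn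
  -- its image misses `f(Y)`, hence lies in `U`
  have hCU : Set.range τ.left.base ⊆ U := by
    rw [hUc]
    rintro _ ⟨t, rfl⟩ ⟨y, hy⟩
    refine hx0 y ?_
    have h1 : (f ≫ fst X0 T).left.base y = (fst X0 T).left.base (f.left.base y) := rfl
    have h2 : (fst X0 T).left.base (τ.left.base t) = (τ ≫ fst X0 T).left.base t := rfl
    rw [h1, hy, h2, hτfst]
    have h3 : (toSpecOver T ≫ x0).left.base t = x0.left.base ((toSpecOver T).left.base t) := rfl
    rw [h3]
    haveI : Subsingleton ↥((specOver ℂ ℂ).left) :=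
      inferInstanceAs (Subsingleton (PrimeSpectrum ℂ))
    rw [Subsingleton.elim ((toSpecOver T).left.base t) (IsLocalRing.closedPoint ℂ)]
    rfl
  -- but it has Krull dimension `d ≥ 1`: a complete positive-dimensional subset of an affine open
  have hdimC : topologicalKrullDim (Set.range τ.left.base) = (d : WithBot ℕ∞) := by
    rw [← topologicalKrullDim_left_eq_of_isSmoothProjective hT]
    exact (IsHomeomorph.topologicalKrullDim_eq _
      τ.left.isClosedEmbedding.isEmbedding.toHomeomorph.isHomeomorph).symm
  have h1 : 1 ≤ topologicalKrullDim (Set.range τ.left.base) := by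
    rw [hdimC]; exact_mod_cast hd
  exact Literature.AlgebraicGeometry.Morphisms.not_subset_affineOpen_of_one_le_topologicalKrullDim
    (X0 ⊗ T).hom hC hCcl h1 hU hCU

/-- **Dimension pinning.** Let `X`, `X₀`, `Y` be smooth projective complex varieties of dimensions
`n + 1`, `n`, `m`, `f : Y ↪ X` a closed immersion which is not surjective, and `g : Y → X₀` a
surjective `ℂ`-morphism. Then `m = n`. Indeed `dim` is the topological Krull dimension
(`topologicalKrullDim_left_eq_of_isSmoothProjective`); `f(Y) ≅ Y` is a proper closed subset of the
irreducible sober space `X`, so `dim Y < n + 1` (Görtz–Wedhorn Prop. 5.30, Hartshorne II Ex. 3.20: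
a proper closed subset of an irreducible space has smaller dimension); and `g` is proper (`Y` proper,
`X₀` separated over `ℂ`; Hartshorne II Cor. 4.8 (e)), hence closed, and surjective, so
`n = dim X₀ ≤ dim Y = m` (chains of specialisations lift along closed surjections; Görtz–Wedhorn
Prop. 12.12, Hartshorne II Ex. 3.22).
[cite: GortzWedhorn2020, Prop. 5.30 and Prop. 12.12] [cite: Hartshorne1977, II Ex. 3.20–3.22 and Cor. 4.8 (e)] -/
theorem eq_of_isClosedImmersion_of_surjective {n m : ℕ} {X X0 Y : SchemeOver ℂ}
    (hX : IsSmoothProjective (n + 1) X) (hX0 : IsSmoothProjective n X0) (hY : IsSmoothProjective m Y)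
    (f : Y ⟶ X) [IsClosedImmersion f.left] (hne : (Set.range f.left.base)ᶜ.Nonempty)
    (g : Y ⟶ X0) [Surjective g.left] : m = n := by
  have hdX := topologicalKrullDim_left_eq_of_isSmoothProjective hX
  have hdX0 := topologicalKrullDim_left_eq_of_isSmoothProjective hX0
  have hdY := topologicalKrullDim_left_eq_of_isSmoothProjective hY
  -- `n ≤ m`: `g` is a proper (hence closed) surjection
  haveI : IsProper X0.hom := IsSmoothProjective.isProper_holds hX0
  haveI : IsProper Y.hom := IsSmoothProjective.isProper_holds hY
  haveI : IsProper (g.left ≫ X0.hom) := by rw [Over.w g]; infer_instance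
  haveI : IsProper g.left := IsProper.of_comp g.left X0.hom
  have hnm : (n : WithBot ℕ∞) ≤ m := by
    rw [← hdX0, ← hdY]
    exact Scheme.topologicalKrullDim_le_of_universallyClosed_of_surjective g.left
  -- `m < n + 1`: `f(Y) ≅ Y` is a proper closed subset of the irreducible `X`
  haveI := hX.geometricallyIrreducible
  haveI : IrreducibleSpace X.left := GeometricallyIrreducible.irreducibleSpace_of_subsingleton X.hom
  have hW : IsClosed (Set.range f.left.base) := f.left.isClosedEmbedding.isClosed_range
  have hWX : Set.range f.left.base ≠ Set.univ := Set.nonempty_compl.mp hne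
  have hlt : topologicalKrullDim (Set.range f.left.base) < ((n + 1 : ℕ) : WithBot ℕ∞) :=
    Literature.Topology.topologicalKrullDim_lt_of_isClosed_ssubset hW hWX (n + 1)
      (by rw [hdX]; exact_mod_cast Nat.lt_add_one (n + 1))
  have hYW : topologicalKrullDim Y.left = topologicalKrullDim (Set.range f.left.base) :=
    IsHomeomorph.topologicalKrullDim_eq _
      f.left.isClosedEmbedding.isEmbedding.toHomeomorph.isHomeomorph
  rw [← hYW, hdY] at hlt
  have h1 : n ≤ m := by exact_mod_cast hnm
  have h2 : m < n + 1 := by exact_mod_cast hlt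
  omega

/-! ### The middle degree from algebraicity on affine-complement sections -/

/-- **(Sec_p) ⇒ the Hodge conjecture in the middle degree of every `2p`-fold.** Suppose every rational
`(p,p)`-class `c` on every smooth projective complex variety `X` of dimension `2p + 1` becomes algebraic
on some admissible proper section (`Y` smooth projective, `f : Y ⟶ X` a closed immersion, `X ∖ f(Y)`
non-empty and covered by a finite set `s` of affine opens with `2p + |s| ≤ 2p + 1`,
`f^* c ∈ algebraicClasses Y p`). Then every rational `(p,p)`-class `c₀` on every smooth projective `X₀`
of dimension `2p` is algebraic: apply the hypothesis to `pr₁^* c₀` on `X₀ × ℙ¹`, read off `s = {U}`,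
note that `f ≫ pr₁ : Y → X₀` is surjective (`surjective_comp_fst_of_isAffineOpen_compl`) and
equidimensional (`eq_of_isClosedImmersion_of_surjective`), and descend
`(f ≫ pr₁)^* c₀ = f^* pr₁^* c₀ ∈ algebraicClasses Y p` by the degree trick
(`mem_algebraicClasses_of_map_mem_of_surjective`, Voisin I Remark 7.29).
[cite: VoisinHodgeI2002, §7.3.2 Remark 7.29] [cite: Deligne2000, §1] [cite: Hartshorne1977, II Ex. 4.5] -/
theorem mem_algebraicClasses_middle_of_affineComplSections {p : ℕ}
    (hSec : ∀ ⦃X : SchemeOver ℂ⦄, IsSmoothProjective (2 * p + 1) X →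
      ∀ c : complexBetti X (2 * p), IsRationalClass c → IsOfHodgeType (2 * p + 1) X (2 * p) p p c →
        ∃ (m : ℕ) (Y : SchemeOver ℂ) (f : Y ⟶ X) (s : Finset X.left.Opens),
          IsSmoothProjective m Y ∧ IsClosedImmersion f.left ∧ (∀ U ∈ s, IsAffineOpen U) ∧
            (⋃ U ∈ s, (U : Set X.left)) = (Set.range f.left.base)ᶜ ∧ 2 * p + s.card ≤ 2 * p + 1 ∧
            Set.Nonempty (Set.range f.left.base)ᶜ ∧ complexBetti.map f (2 * p) c ∈ algebraicClasses Y p)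
    ⦃X0 : SchemeOver ℂ⦄ (hX0 : IsSmoothProjective (2 * p) X0) (c0 : complexBetti X0 (2 * p))
    (hc : IsRationalClass c0) (hh : IsOfHodgeType (2 * p) X0 (2 * p) p p c0) :
    c0 ∈ algebraicClasses X0 p := by
  -- `X := X₀ × ℙ¹` is smooth projective of dimension `2p + 1`
  have hP1 : IsSmoothProjective 1 (projectiveSpace 1 ℂ) := isSmoothProjective_projectiveSpace_holds ℂ 1
  have hX : IsSmoothProjective (2 * p + 1) (X0 ⊗ projectiveSpace 1 ℂ) :=
    IsSmoothProjective.tensor_holds hX0 hP1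
  -- `c := pr₁^* c₀` is rational and of Hodge type `(p,p)` (Voisin I §7.3.2)
  have hfst : PreservesHodgeType (2 * p + 1) (2 * p) (fst X0 (projectiveSpace 1 ℂ)) :=
    preservesHodgeType_of_nonempty_hodgeModel hodgePQ_independent_of_hodgeModel_holds
      nonempty_hodgeModel_holds hX hX0 (fst X0 (projectiveSpace 1 ℂ))
  have hc' : IsRationalClass (complexBetti.map (fst X0 (projectiveSpace 1 ℂ)) (2 * p) c0) :=
    hc.map (AlgPoints.mapContinuous (L := ℂ) (fst X0 (projectiveSpace 1 ℂ)))
  have hh' : IsOfHodgeType (2 * p + 1) (X0 ⊗ projectiveSpace 1 ℂ) (2 * p) p p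
      (complexBetti.map (fst X0 (projectiveSpace 1 ℂ)) (2 * p) c0) :=
    hfst hh
  -- the hypothesis at `pr₁^* c₀`
  obtain ⟨m, Y, f, s, hY, hf, hs, hcov, hle, hne, halg⟩ := hSec hX _ hc' hh'
  -- `s` is a single affine open `U` with `U = X ∖ f(Y)`
  obtain ⟨x, hx⟩ := id hne
  rw [← hcov, Set.mem_iUnion₂] at hx
  obtain ⟨U, hU, -⟩ := hx
  have hsU : s = {U} :=
    Finset.eq_singleton_iff_unique_mem.mpr
      ⟨hU, fun V hV => Finset.card_le_one.mp (by omega) V hV U hU⟩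
  subst hsU
  simp only [Finset.mem_singleton, Set.iUnion_iUnion_eq_left] at hcov
  -- dominance and dimension
  haveI := hf
  haveI : Surjective (f ≫ fst X0 (projectiveSpace 1 ℂ)).left :=
    surjective_comp_fst_of_isAffineOpen_compl hX0 hP1 le_rfl f U (hs U hU) hcov
  obtain rfl : m = 2 * p :=
    eq_of_isClosedImmersion_of_surjective hX hX0 hY f hne (f ≫ fst X0 (projectiveSpace 1 ℂ))
  -- descent along the surjective equidimensional `f ≫ pr₁`
  refine mem_algebraicClasses_of_map_mem_of_surjective hY hX0 (f ≫ fst X0 (projectiveSpace 1 ℂ)) ?_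
  rw [complexBetti.map_comp, CategoryTheory.comp_apply]
  exact halg

/-- **(Sec_2) ⇒ the Hodge conjecture for `(2,2)`-classes on every smooth projective fourfold** (the
case `p = 2` of `mem_algebraicClasses_middle_of_affineComplSections`). [cite: Deligne2000, §1]
[cite: VoisinHodgeI2002, §7.3.2 Remark 7.29] -/
theorem mem_algebraicClasses_fourfold_of_affineComplSections
    (hSec : ∀ ⦃X : SchemeOver ℂ⦄, IsSmoothProjective (2 * 2 + 1) X →
      ∀ c : complexBetti X (2 * 2), IsRationalClass c → IsOfHodgeType (2 * 2 + 1) X (2 * 2) 2 2 c →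
        ∃ (m : ℕ) (Y : SchemeOver ℂ) (f : Y ⟶ X) (s : Finset X.left.Opens),
          IsSmoothProjective m Y ∧ IsClosedImmersion f.left ∧ (∀ U ∈ s, IsAffineOpen U) ∧
            (⋃ U ∈ s, (U : Set X.left)) = (Set.range f.left.base)ᶜ ∧ 2 * 2 + s.card ≤ 2 * 2 + 1 ∧
            Set.Nonempty (Set.range f.left.base)ᶜ ∧ complexBetti.map f (2 * 2) c ∈ algebraicClasses Y 2)
    ⦃X : SchemeOver ℂ⦄ (hX : IsSmoothProjective 4 X) (c : complexBetti X 4) (hc : IsRationalClass c)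
    (hh : IsOfHodgeType 4 X 4 2 2 c) : c ∈ algebraicClasses X 2 :=
  mem_algebraicClasses_middle_of_affineComplSections hSec hX c hc hh

end HodgeTheory

end Literature.AlgebraicGeometry.HodgeTheory

end
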